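import Literature.NumberTheory.ConnesConsani2021.ArchKernelL1PanelFrame
import HarnessLib

/-!
# The certificate kernel as a cosine sum: `L · Re τ_c(L u) = c₀ + 2 Σ_{1 ≤ n ≤ N} c_n cos(π n u)`

LINE 1 — FRAMING: RH-FREE elementary bookkeeping (pairing `n, −n` in a symmetric exponential sum);
cell rh-crit, corpus C1, seat t12 g2, Tier-2 ANALYTIC SUPPORT (cc-lead R110 (v)(a), 2026-08-26) for
the (E-a) kernel certificate of `CC2021_section6_enclosures` (eng-1 g2 / cc-iso g4 design of record:
degree-`k` Taylor models of `σ(u) := L·τ_c(Lu)` on coarse panels).  bears_on: W-C/W-P (K3 stmt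
`WindowSpectralBound`, item 19306).  WHAT THIS IS NOT: a certificate, an enclosure, or any claim about
RH — nothing here bears on the truth of RH.

Source: A. Connes, C. Consani, *Weil positivity and trace formula, the archimedean place*, Selecta
Math. 27 (2021) [bib `ConnesConsani2021`], §6.4 display (opkf1) p. 24 — the trigonometric kernel
`τ = Σ_{|n| ≤ N} c_{|n|} κ_{n/2}`, `κ_α(v) = L⁻¹ e^{2πiαv/L}` (tree: `SpectralCert.frameKernel`,
`expKernel`, file `SpectralCertFrame.lean`; realness/evenness: `ArchKernelL1PanelFrame.lean`).

## What is here (theorems only: 0 definitions, 0 named facts)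

* `SpectralCert.re_frameKernel_eq_cos_sum (a b N c v) :
    Re τ_c(v) = (b−a)⁻¹ · (c 0 + 2 Σ_{n ∈ Icc 1 N} c n · cos(π n v/(b−a)))` (no hypothesis on `a, b`);
* **`SpectralCert.re_frameKernel_mul_eq_cos_sum (hab : a ≠ b) (N c u) :
    (b−a) · Re τ_c((b−a)·u) = c 0 + 2 Σ_{n ∈ Icc 1 N} c n · cos(π n u)`** — eng-1's `σ(u)`.
* (v)(b) `SpectralCert.abs_re_frameKernel_sub_taylor_le (a b N c v₀ w D)` — Taylor's theorem for
  `Re τ_c` at any centre `v₀`, any degree `D`, with EXPLICIT coefficients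
  `a_j = L⁻¹(δ_{j0}c₀ + 2Σ c_n (πn/L)^j cos^{(j)}(πn v₀/L))/j!` and the GLOBAL remainder
  `|L⁻¹|·(2Σ|c_n||πn/L|^{D+1})·|w|^{D+1}/(D+1)!` (eng-1 g2's 12:00Z shape: degree 12, 64 centres);
  helpers `iteratedDeriv_cos_eq_cos_add` (`cos^{(j)}(x) = cos(x + jπ/2)`) and `abs_cos_sub_taylor_le`
  (Lagrange remainder of `cos`, `|y|^{N+1}/(N+1)!`);
* `re_certKernel_eq_cos_sum`, `abs_re_certKernel_sub_taylor_le` — the same two statements on the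
  certificate window `[−log 2/2, log 2/2]` with `L = log 2` simplified (no absolute values left).
-/

noncomputable section

open Real Finset
open scoped Nat ContDiff

namespace Literature.NumberTheory.ConnesConsani2021

namespace SpectralCert

/-- Pairing `n` with `−n` in a symmetric integer window:
`Σ_{n=−N}^{N} g(n) = g(0) + Σ_{n=1}^{N} (g(n) + g(−n))`. [folklore] -/
private theorem sum_Icc_neg_nat_eq (g : ℤ → ℝ) (N : ℕ) :
    ∑ n ∈ Finset.Icc (-(N : ℤ)) N, g n = g 0 + ∑ n ∈ Finset.Icc 1 N, (g (n : ℤ) + g (-(n : ℤ))) := by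
  have hsplit : Finset.Icc (-(N : ℤ)) N =
      Finset.Icc (-(N : ℤ)) (-1) ∪ ({(0 : ℤ)} ∪ Finset.Icc (1 : ℤ) N) := by
    ext n
    simp only [Finset.mem_union, Finset.mem_Icc, Finset.mem_singleton]
    omega
  have hd1 : Disjoint (Finset.Icc (-(N : ℤ)) (-1)) ({(0 : ℤ)} ∪ Finset.Icc (1 : ℤ) N) := by
    rw [Finset.disjoint_left]
    intro n hn hn'
    simp only [Finset.mem_union, Finset.mem_Icc, Finset.mem_singleton] at hn hn'
    omega
  have hd2 : Disjoint ({(0 : ℤ)} : Finset ℤ) (Finset.Icc (1 : ℤ) N) := by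
    rw [Finset.disjoint_left]
    intro n hn hn'
    simp only [Finset.mem_Icc, Finset.mem_singleton] at hn hn'
    omega
  have hneg : ∑ n ∈ Finset.Icc (-(N : ℤ)) (-1), g n = ∑ n ∈ Finset.Icc (1 : ℤ) N, g (-n) := by
    refine Finset.sum_nbij' (fun n ↦ -n) (fun n ↦ -n) ?_ ?_ ?_ ?_ ?_
    · intro n hn; simp only [Finset.mem_Icc] at hn ⊢; omega
    · intro n hn; simp only [Finset.mem_Icc] at hn ⊢; omega
    · intro n _; simp
    · intro n _; simp
    · intro n _; simp
  have hpos : ∀ h : ℤ → ℝ, ∑ n ∈ Finset.Icc (1 : ℤ) N, h n = ∑ n ∈ Finset.Icc 1 N, h (n : ℤ) := by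
    intro h
    refine Finset.sum_nbij' (fun n ↦ n.toNat) (fun n ↦ (n : ℤ)) ?_ ?_ ?_ ?_ ?_
    · intro n hn; simp only [Finset.mem_Icc] at hn ⊢; omega
    · intro n hn; simp only [Finset.mem_Icc] at hn ⊢; omega
    · intro n hn; simp only [Finset.mem_Icc] at hn; simp; omega
    · intro n _; simp
    · intro n hn; simp only [Finset.mem_Icc] at hn; congr 1; omega
  rw [hsplit, Finset.sum_union hd1, Finset.sum_union hd2, Finset.sum_singleton, hneg, hpos g,
    hpos (fun n ↦ g (-n)), Finset.sum_add_distrib]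
  ring

/-- The real part of one term: `Re (c · κ_{n/2}(v)) = c · (b−a)⁻¹ · cos(π n v/(b−a))`.
[cite: ConnesConsani2021, §6.4 display (opkf1) p. 24] -/
theorem re_ofReal_mul_expKernel (a b c : ℝ) (n : ℤ) (v : ℝ) :
    (((c : ℝ) : ℂ) * expKernel a b ((n : ℝ) / 2) v).re = c * (b - a)⁻¹ * Real.cos (π * n * v / (b - a)) := by
  rw [expKernel, ← mul_assoc, ← Complex.ofReal_mul, Complex.re_ofReal_mul, Complex.exp_ofReal_mul_I_re]
  congr 2
  ring

/-- **`Re τ_c` as a cosine sum**: `Re τ_c(v) = (b−a)⁻¹ (c₀ + 2 Σ_{n=1}^{N} c_n cos(π n v/(b−a)))`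
(pair `n` with `−n`; `c_{|−n|} = c_n`, `cos` even).  No hypothesis on `a, b`.
[cite: ConnesConsani2021, §6.4 display (opkf1) p. 24] -/
theorem re_frameKernel_eq_cos_sum (a b : ℝ) (N : ℕ) (c : ℕ → ℝ) (v : ℝ) :
    (frameKernel a b N c v).re =
      (b - a)⁻¹ * (c 0 + 2 * ∑ n ∈ Finset.Icc 1 N, c n * Real.cos (π * n * v / (b - a))) := by
  have h1 : (frameKernel a b N c v).re =
      ∑ n ∈ Finset.Icc (-(N : ℤ)) N, c n.natAbs * (b - a)⁻¹ * Real.cos (π * n * v / (b - a)) := by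
    rw [frameKernel, Complex.re_sum]
    exact Finset.sum_congr rfl fun n _ ↦ re_ofReal_mul_expKernel a b _ n v
  have h2 := sum_Icc_neg_nat_eq (fun n : ℤ ↦ c n.natAbs * (b - a)⁻¹ * Real.cos (π * n * v / (b - a))) N
  have h0 : c (Int.natAbs 0) * (b - a)⁻¹ * Real.cos (π * ((0 : ℤ) : ℝ) * v / (b - a)) =
      (b - a)⁻¹ * c 0 := by
    simp [mul_comm]
  have hterm : ∀ n : ℕ,
      c (Int.natAbs (n : ℤ)) * (b - a)⁻¹ * Real.cos (π * (((n : ℤ)) : ℝ) * v / (b - a)) +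
      c (Int.natAbs (-(n : ℤ))) * (b - a)⁻¹ * Real.cos (π * ((-(n : ℤ) : ℤ) : ℝ) * v / (b - a)) =
      (b - a)⁻¹ * (2 * (c n * Real.cos (π * n * v / (b - a)))) := by
    intro n
    simp only [Int.natAbs_neg, Int.natAbs_natCast, Int.cast_neg, Int.cast_natCast]
    rw [show π * -(n : ℝ) * v / (b - a) = -(π * n * v / (b - a)) by ring, Real.cos_neg]
    ring
  rw [h1, h2, h0, Finset.sum_congr rfl fun n _ ↦ hterm n, ← Finset.mul_sum, ← Finset.mul_sum]
  ring

/-- **eng-1's `σ(u)`: `(b−a) · Re τ_c((b−a)u) = c₀ + 2 Σ_{1≤n≤N} c_n cos(π n u)`** (`a ≠ b`).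
[cite: ConnesConsani2021, §6.4 display (opkf1) p. 24] -/
theorem re_frameKernel_mul_eq_cos_sum {a b : ℝ} (hab : a ≠ b) (N : ℕ) (c : ℕ → ℝ) (u : ℝ) :
    (b - a) * (frameKernel a b N c ((b - a) * u)).re =
      c 0 + 2 * ∑ n ∈ Finset.Icc 1 N, c n * Real.cos (π * n * u) := by
  have hL : b - a ≠ 0 := sub_ne_zero.2 (Ne.symm hab)
  rw [re_frameKernel_eq_cos_sum, ← mul_assoc, mul_inv_cancel₀ hL, one_mul]
  congr 2
  refine Finset.sum_congr rfl fun n _ ↦ ?_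
  rw [show π * n * ((b - a) * u) / (b - a) = π * n * u by field_simp]

/-! ## (v)(b) Taylor's theorem with a GLOBAL remainder for the cosine sum

For `f(v) = Re τ_c(v) = L⁻¹(c₀ + 2Σ c_n cos(ω_n v))`, `ω_n = πn/L`, the degree-`D` Taylor polynomial at
`v₀` has the explicit coefficients `a_j = L⁻¹(δ_{j0} c₀ + 2Σ_n c_n ω_n^j cos^{(j)}(ω_n v₀))/j!`,
`cos^{(j)}(x) = cos(x + jπ/2)`, and the remainder is bounded GLOBALLY (no dependence on `v₀`) by
`|L⁻¹|·2Σ|c_n||ω_n|^{D+1}·|w|^{D+1}/(D+1)!` — termwise Lagrange remainders of `cos`. -/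

/-- `cos^{(j)}(x) = cos(x + jπ/2)`. [cite: ConnesConsani2021, §6.4 display (opkf1) p. 24 (the trigonometric kernel); folklore calculus] -/
theorem iteratedDeriv_cos_eq_cos_add (j : ℕ) (x : ℝ) :
    iteratedDeriv j Real.cos x = Real.cos (x + j * (π / 2)) := by
  induction j generalizing x with
  | zero => simp
  | succ j ih =>
    rw [iteratedDeriv_succ', Real.deriv_cos']
    have h : iteratedDeriv j (fun x ↦ -Real.sin x) x = iteratedDeriv j (fun x ↦ Real.cos (x + π / 2)) x := by
      congr 1; funext y; rw [Real.cos_add_pi_div_two]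
    rw [h, iteratedDeriv_comp_add_const]
    simp only [ih]
    congr 1
    push_cast
    ring

/-- **Taylor's theorem with Lagrange remainder, sup-norm form**: for `g ∈ C^∞(ℝ)` with
`|g^{(N+1)}| ≤ K` on `[t₀, t₀ + y]`,
`|g(t₀ + y) − Σ_{k ≤ N} g^{(k)}(t₀) y^k/k!| ≤ K |y|^{N+1}/(N+1)!`. [folklore] -/
private theorem abs_sub_taylor_le_of_iteratedDeriv_le {g : ℝ → ℝ} (hg : ContDiff ℝ ∞ g) {K t₀ y : ℝ}
    (N : ℕ) (hb : ∀ t ∈ Set.uIcc t₀ (t₀ + y), |iteratedDeriv (N + 1) g t| ≤ K) :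
    |g (t₀ + y) - ∑ k ∈ Finset.range (N + 1), iteratedDeriv k g t₀ * y ^ k / k !| ≤
      K * |y| ^ (N + 1) / (N + 1)! := by
  have hK : 0 ≤ K := (abs_nonneg _).trans (hb t₀ Set.left_mem_uIcc)
  rcases eq_or_ne y 0 with hy | hy
  · subst hy
    rw [Finset.sum_range_succ', Finset.sum_eq_zero (fun k _ ↦ by simp)]
    simp
  set x := t₀ + y with hx
  have hne : t₀ ≠ x := by simp [hx, hy]
  have hU : UniqueDiffOn ℝ (Set.uIcc t₀ x) := uniqueDiffOn_Icc (inf_lt_sup.mpr hne)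
  have hwithin : ∀ k, ∀ t ∈ Set.uIcc t₀ x, iteratedDerivWithin k g (Set.uIcc t₀ x) t =
      iteratedDeriv k g t := fun k t ht ↦
    iteratedDerivWithin_eq_iteratedDeriv hU ((hg.of_le (mod_cast le_top)).contDiffAt) ht
  have hpoly : taylorWithinEval g N (Set.uIcc t₀ x) t₀ x =
      ∑ k ∈ Finset.range (N + 1), iteratedDeriv k g t₀ * y ^ k / k ! := by
    rw [taylor_within_apply]
    refine Finset.sum_congr rfl fun k _ ↦ ?_
    rw [hwithin k t₀ Set.left_mem_uIcc, smul_eq_mul, hx, add_sub_cancel_left]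
    field_simp
  have hgN : ContDiffOn ℝ N g (Set.uIcc t₀ x) := (hg.of_le (mod_cast le_top)).contDiffOn
  have hdiff : DifferentiableOn ℝ (iteratedDerivWithin N g (Set.uIcc t₀ x)) (Set.uIoo t₀ x) := by
    have hd : DifferentiableOn ℝ (iteratedDeriv N g) (Set.uIoo t₀ x) :=
      (hg.differentiable_iteratedDeriv N (mod_cast WithTop.coe_lt_top _)).differentiableOn
    exact hd.congr fun t ht ↦ hwithin N t (Set.uIoo_subset_uIcc_self ht)
  obtain ⟨x', hx', hrem⟩ := taylor_mean_remainder_lagrange hne hgN hdiff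
  rw [← hpoly, hrem, hwithin (N + 1) x' (Set.uIoo_subset_uIcc_self hx'), hx, add_sub_cancel_left,
    abs_div, abs_mul, abs_pow, Nat.abs_cast]
  exact div_le_div_of_nonneg_right (mul_le_mul_of_nonneg_right (hb x' (Set.uIoo_subset_uIcc_self hx'))
    (by positivity)) (by positivity)

/-- **Lagrange remainder for `cos`, global form**:
`|cos(x₀ + y) − Σ_{k ≤ N} cos^{(k)}(x₀) y^k/k!| ≤ |y|^{N+1}/(N+1)!` (`|cos^{(N+1)}| ≤ 1`).
[cite: ConnesConsani2021, §6.4 display (opkf1) p. 24 (the trigonometric kernel); folklore calculus] -/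
theorem abs_cos_sub_taylor_le (x₀ y : ℝ) (N : ℕ) :
    |Real.cos (x₀ + y) - ∑ k ∈ Finset.range (N + 1), iteratedDeriv k Real.cos x₀ * y ^ k / k !| ≤
      |y| ^ (N + 1) / (N + 1)! := by
  have h := abs_sub_taylor_le_of_iteratedDeriv_le Real.contDiff_cos (K := 1) (t₀ := x₀) (y := y) N
    (fun t _ ↦ Real.abs_iteratedDeriv_cos_le_one (N + 1) t)
  simpa using h

/-- **(v)(b) Taylor model of `Re τ_c` with a global remainder.**  For every centre `v₀`, increment `w`
and degree `D`:
`|Re τ_c(v₀ + w) − Σ_{j ≤ D} a_j w^j| ≤ |L⁻¹| · (2 Σ_{n=1}^{N} |c_n| |πn/L|^{D+1}) · |w|^{D+1}/(D+1)!`,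
with the EXPLICIT Taylor coefficients
`a_j = L⁻¹ · (δ_{j0} c₀ + 2 Σ_{n=1}^{N} c_n (πn/L)^j cos^{(j)}(πn v₀/L)) / j!` (`L = b − a`,
`cos^{(j)} = iteratedDeriv j cos`, see `iteratedDeriv_cos_eq_cos_add`).  Termwise
`abs_cos_sub_taylor_le` at `x₀ = πn v₀/L`, `y = (πn/L) w`, and the triangle inequality.
[cite: ConnesConsani2021, §6.4 display (opkf1) p. 24 and Fact 6.1 (the kernel certificate this serves)] -/
theorem abs_re_frameKernel_sub_taylor_le (a b : ℝ) (N : ℕ) (c : ℕ → ℝ) (v₀ w : ℝ) (D : ℕ) :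
    |(frameKernel a b N c (v₀ + w)).re -
        ∑ j ∈ Finset.range (D + 1),
          (b - a)⁻¹ * ((if j = 0 then c 0 else 0) +
            2 * ∑ n ∈ Finset.Icc 1 N, c n * (π * n / (b - a)) ^ j *
              iteratedDeriv j Real.cos (π * n * v₀ / (b - a))) / j ! * w ^ j| ≤
      |(b - a)⁻¹| * (2 * ∑ n ∈ Finset.Icc 1 N, |c n| * |π * n / (b - a)| ^ (D + 1)) *
        |w| ^ (D + 1) / (D + 1)! := by
  set L := b - a with hL
  -- per-mode Taylor polynomial and remainder
  set T : ℕ → ℝ := fun n ↦ ∑ j ∈ Finset.range (D + 1),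
    iteratedDeriv j Real.cos (π * n * v₀ / L) * ((π * n / L) * w) ^ j / j ! with hT
  have hterm : ∀ n : ℕ, |Real.cos (π * n * (v₀ + w) / L) - T n| ≤
      |π * n / L| ^ (D + 1) * |w| ^ (D + 1) / (D + 1)! := by
    intro n
    have h := abs_cos_sub_taylor_le (π * n * v₀ / L) ((π * n / L) * w) D
    rw [show π * n * v₀ / L + π * n / L * w = π * n * (v₀ + w) / L by ring, abs_mul, mul_pow] at h
    exact h
  -- the Taylor sum, re-assembled mode by mode
  set S : ℕ → ℕ → ℝ := fun j n ↦
    c n * (π * n / L) ^ j * iteratedDeriv j Real.cos (π * n * v₀ / L) / j ! * w ^ j with hS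
  have h0 : ∑ j ∈ Finset.range (D + 1), L⁻¹ * (if j = 0 then c 0 else 0) / j ! * w ^ j =
      L⁻¹ * c 0 := by
    rw [Finset.sum_eq_single 0 (fun j _ hj ↦ by simp [hj]) (fun h ↦ by simp at h)]
    simp
  have h1 : ∀ n : ℕ, c n * T n = ∑ j ∈ Finset.range (D + 1), S j n := by
    intro n
    rw [hT, hS, Finset.mul_sum]
    refine Finset.sum_congr rfl fun j _ ↦ ?_
    simp only [mul_pow]
    ring
  have hL1 : ∀ j : ℕ, L⁻¹ * ((if j = 0 then c 0 else 0) +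
      2 * ∑ n ∈ Finset.Icc 1 N, c n * (π * n / L) ^ j *
        iteratedDeriv j Real.cos (π * n * v₀ / L)) / j ! * w ^ j =
      L⁻¹ * (if j = 0 then c 0 else 0) / j ! * w ^ j + L⁻¹ * 2 * ∑ n ∈ Finset.Icc 1 N, S j n := by
    intro j
    rw [mul_add, add_div, add_mul]
    congr 1
    simp only [hS, Finset.mul_sum, Finset.sum_div, Finset.sum_mul]
    refine Finset.sum_congr rfl fun n _ ↦ ?_
    ring
  have hswap : ∑ j ∈ Finset.range (D + 1),
      L⁻¹ * ((if j = 0 then c 0 else 0) +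
        2 * ∑ n ∈ Finset.Icc 1 N, c n * (π * n / L) ^ j *
          iteratedDeriv j Real.cos (π * n * v₀ / L)) / j ! * w ^ j =
      L⁻¹ * (c 0 + 2 * ∑ n ∈ Finset.Icc 1 N, c n * T n) := by
    calc _ = ∑ j ∈ Finset.range (D + 1), (L⁻¹ * (if j = 0 then c 0 else 0) / j ! * w ^ j +
          L⁻¹ * 2 * ∑ n ∈ Finset.Icc 1 N, S j n) := Finset.sum_congr rfl fun j _ ↦ hL1 j
      _ = L⁻¹ * c 0 + L⁻¹ * 2 * ∑ j ∈ Finset.range (D + 1), ∑ n ∈ Finset.Icc 1 N, S j n := by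
          rw [Finset.sum_add_distrib, ← Finset.mul_sum, h0]
      _ = L⁻¹ * c 0 + L⁻¹ * 2 * ∑ n ∈ Finset.Icc 1 N, c n * T n := by
          rw [Finset.sum_comm]
          congr 2
          exact Finset.sum_congr rfl fun n _ ↦ (h1 n).symm
      _ = _ := by ring
  rw [hswap, re_frameKernel_eq_cos_sum, ← hL, ← mul_sub, abs_mul, mul_assoc, mul_div_assoc, mul_assoc]
  refine mul_le_mul_of_nonneg_left ?_ (abs_nonneg _)
  have hdiff : c 0 + 2 * ∑ n ∈ Finset.Icc 1 N, c n * Real.cos (π * n * (v₀ + w) / L) -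
      (c 0 + 2 * ∑ n ∈ Finset.Icc 1 N, c n * T n) =
      2 * ∑ n ∈ Finset.Icc 1 N, c n * (Real.cos (π * n * (v₀ + w) / L) - T n) := by
    rw [add_sub_add_left_eq_sub, ← mul_sub, ← Finset.sum_sub_distrib]
    congr 1
    exact Finset.sum_congr rfl fun n _ ↦ by ring
  rw [hdiff, abs_mul, abs_two]
  have key : |∑ n ∈ Finset.Icc 1 N, c n * (Real.cos (π * n * (v₀ + w) / L) - T n)| ≤
      (∑ n ∈ Finset.Icc 1 N, |c n| * |π * n / L| ^ (D + 1)) * (|w| ^ (D + 1) / (D + 1)!) := by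
    rw [Finset.sum_mul]
    refine le_trans (Finset.abs_sum_le_sum_abs _ _) ?_
    refine Finset.sum_le_sum fun n _ ↦ ?_
    rw [abs_mul]
    calc |c n| * |Real.cos (π * n * (v₀ + w) / L) - T n|
          ≤ |c n| * (|π * n / L| ^ (D + 1) * |w| ^ (D + 1) / (D + 1)!) :=
            mul_le_mul_of_nonneg_left (hterm n) (abs_nonneg _)
      _ = |c n| * |π * n / L| ^ (D + 1) * (|w| ^ (D + 1) / (D + 1)!) := by ring
  have h2 : (0 : ℝ) ≤ 2 := by norm_num
  calc 2 * |∑ n ∈ Finset.Icc 1 N, c n * (Real.cos (π * n * (v₀ + w) / L) - T n)|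
        ≤ 2 * ((∑ n ∈ Finset.Icc 1 N, |c n| * |π * n / L| ^ (D + 1)) * (|w| ^ (D + 1) / (D + 1)!)) :=
          mul_le_mul_of_nonneg_left key h2
    _ = _ := by ring

/-! ## Specialization to the certificate window `[a, b] = [−log 2/2, log 2/2]` (`L = log 2`)

The frame `ArchKernelL1Frame.section6_enclosures_iff_L1` instantiates `τ_c` as
`frameKernel (−(log 2/2)) (log 2/2) CertAF.N (fun n ↦ (CertAF.c n : ℝ))`; the two lemmas below are the
cosine-sum and Taylor statements with `b − a = log 2` already simplified. -/

/-- `Re τ_c(v) = (log 2)⁻¹ (c₀ + 2 Σ_{n=1}^{N} c_n cos(π n v/log 2))` on the certificate window.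
[cite: ConnesConsani2021, §6.4 display (opkf1) p. 24] -/
theorem re_certKernel_eq_cos_sum (N : ℕ) (c : ℕ → ℝ) (v : ℝ) :
    (frameKernel (-(Real.log 2 / 2)) (Real.log 2 / 2) N c v).re =
      (Real.log 2)⁻¹ * (c 0 + 2 * ∑ n ∈ Finset.Icc 1 N, c n * Real.cos (π * n * v / Real.log 2)) := by
  rw [re_frameKernel_eq_cos_sum, show Real.log 2 / 2 - -(Real.log 2 / 2) = Real.log 2 by ring]

/-- **Taylor model of `Re τ_c` on the certificate window** (`L = log 2`): for every centre `v₀`,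
increment `w` and degree `D`,
`|Re τ_c(v₀ + w) − Σ_{j ≤ D} a_j w^j| ≤ (log 2)⁻¹·(2Σ_{n=1}^{N}|c_n|(πn/log 2)^{D+1})·|w|^{D+1}/(D+1)!`,
`a_j = (log 2)⁻¹(δ_{j0}c₀ + 2Σ c_n (πn/log 2)^j cos^{(j)}(πn v₀/log 2))/j!`.
[cite: ConnesConsani2021, §6.4 display (opkf1) p. 24 and Fact 6.1] -/
theorem abs_re_certKernel_sub_taylor_le (N : ℕ) (c : ℕ → ℝ) (v₀ w : ℝ) (D : ℕ) :
    |(frameKernel (-(Real.log 2 / 2)) (Real.log 2 / 2) N c (v₀ + w)).re -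
        ∑ j ∈ Finset.range (D + 1),
          (Real.log 2)⁻¹ * ((if j = 0 then c 0 else 0) +
            2 * ∑ n ∈ Finset.Icc 1 N, c n * (π * n / Real.log 2) ^ j *
              iteratedDeriv j Real.cos (π * n * v₀ / Real.log 2)) / j ! * w ^ j| ≤
      (Real.log 2)⁻¹ * (2 * ∑ n ∈ Finset.Icc 1 N, |c n| * (π * n / Real.log 2) ^ (D + 1)) *
        |w| ^ (D + 1) / (D + 1)! := by
  have h := abs_re_frameKernel_sub_taylor_le (-(Real.log 2 / 2)) (Real.log 2 / 2) N c v₀ w D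
  have hL : Real.log 2 / 2 - -(Real.log 2 / 2) = Real.log 2 := by ring
  have hlog : 0 < Real.log 2 := Real.log_pos one_lt_two
  rw [hL, abs_of_pos (inv_pos.2 hlog)] at h
  have habs : ∀ n : ℕ, |π * n / Real.log 2| = π * n / Real.log 2 := fun n ↦
    abs_of_nonneg (by positivity)
  simp only [habs] at h
  exact h

end SpectralCert

end Literature.NumberTheory.ConnesConsani2021

end
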